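import Summits.Ventures.YMGap.RobustBall.LocalSourceOneState
import Summits.Ventures.YMGap.RobustBall.LocalSourceOneStateS
import Summits.Ventures.YMGap.RobustBall.LoopActionNorm
import HarnessLib

/-!
# Venture YMGap, track ROBUST-BALL (Y2) — FINITELY MANY WILSON LOOPS OF ANY STRENGTH CREATE NO PHASE (loop-source bookkeeping
# for `LocalSourceOneState[S].lean`)

HONEST FRAMING. WHAT THIS IS: a venture file (cell `pub-ymgap`, track Y2 ROBUST-BALL, seat rb-p1, theorems only): the loop-family
instances of the «local sources create no phases» theorems.  A FINITE family of closed lattice walks `γ'` with ARBITRARY real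
couplings `c'` is a bounded local source with finitely many listed terms:
* `loopNormLE_fintype` — its loop-action norm is `≤ Σ_i |c'_i| · |γ'_i|`; `memBallZd_loopFamilyAction_fintype` — it is a tier-1
  member of SOME radii (continuity, own-link dependence, support family `loopSupp γ'`);
* `loopFamilyAction_single_apply` / `sum_singleLoop_source` — for ONE loop the source term on its carrier, and the catalogue
  energy, ARE `t · Re tr U_w/N` (`loopTerm N t w`);
* ★ `hasUniqueGibbsMeasure_loopBall_add_loops` — a generic Wilson-type loop action in the norm ball `‖c‖_w ≤ ε` of a
  `MassGapOnLoopBall` row PLUS finitely many further loops with arbitrary real couplings has exactly one DLR state (tier 2;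
  cells `su2_loopBall_add_loops_hasUniqueGibbsMeasure_1_16/_1_20`, `suN_loopBall_add_loops_hasUniqueGibbsMeasure_1_64`);
* ★ `hasUniqueGibbsMeasure_add_loops_of_uniformMassGapOnBallZdG` — every member of ds-2's gauge-invariant ball carrying the
  uniform currency, plus finitely many loops of any strengths, has exactly one DLR state (tier 1); the `SU(2)` Wilson point on
  `ℤ⁴` at `0 ≤ β_W ≤ 1/3` with finitely many loops of any strengths: `su2_wilson_loops_hasUniqueGibbsMeasure_upTo_oneThird`.
WHAT THIS IS NOT: finitely many loops only (an infinite family with summable norm is a MEMBER, not a source — that is the loop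
ball itself); lattice, strong coupling (the rows); nothing about the continuum limit or a Clay-sense mass gap.
-/

noncomputable section

open MeasureTheory Function Finset Real
open Literature.Probability.LatticeModels
open Literature.MathematicalPhysics.QuantumLattice
open Literature.MathematicalPhysics.QuantumFieldTheory hiding ZdEdge Site

namespace Summit.Ventures.YMGap.RobustBall

variable {d N : ℕ}


/-! ### The loop-action norm ball plus finitely many loops of any strength -/

section Loops

variable {ι : Type} {ι' : Type*}

/-- **A finite loop family has loop-action norm `≤ Σ_i |c_i| · |γ_i|`** (`|γ_i|` = the length; unweighted norm `w = 0`). -/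
theorem loopNormLE_fintype [Fintype ι'] (γ' : ι' → ZdLoop d) (c' : ι' → ℝ) :
    LoopNormLE 0 γ' c' (∑ i, |c' i| * (γ' i).walk.length) := by
  have hle : ∀ (e : ZdEdge d) (i : ι'), loopWeightAt 0 γ' c' e i ≤ |c' i| * (γ' i).walk.length := by
    intro e i
    unfold loopWeightAt
    split_ifs
    · simp only [zero_mul, Real.exp_zero, mul_one]
      rw [← Nat.cast_sum, sum_walkEdges_dartMult]
    · positivity
  refine ⟨Finset.sum_nonneg fun i _ => by positivity, fun e => (hasSum_fintype _).summable, fun e => ?_⟩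
  rw [tsum_fintype]
  exact Finset.sum_le_sum fun i _ => hle e i

/-- A finite loop family is a tier-1 member (of some radii): continuity, own-link dependence and the support family
`loopSupp γ'` of its action. -/
theorem memBallZd_loopFamilyAction_fintype [Fintype ι'] (γ' : ι' → ZdLoop d) (c' : ι' → ℝ) :
    MemBallZd (2 * ∑ i, |c' i| * (γ' i).walk.length) (∑ i, |c' i| * (γ' i).walk.length)
      (2 * ∑ i, ((γ' i).walk.length : ℝ)) (loopFamilyAction (d := d) N γ' c') (loopSupp γ') := by
  refine memBallZd_loopFamilyAction (fun _ => Set.toFinite _) (fun _ => Set.toFinite _) (fun i e he y hy => ?_)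
    (loopNormLE_fintype γ' c')
  refine (norm_sub_le_two_mul_length_of_mem_walkEdges (γ' i).walk he hy).trans ?_
  rw [Finset.mul_sum]
  exact Finset.single_le_sum (f := fun j => 2 * ((γ' j).walk.length : ℝ)) (fun j _ => by positivity) (Finset.mem_univ i)

/-- **A LOOP ACTION IN THE NORM BALL PLUS FINITELY MANY LOOPS OF ANY STRENGTH HAS ONE DLR STATE.** If the row
`MassGapOnLoopBall d N β w ε` holds, then for every loop family `γ` (finite carrier fibres) with couplings `‖c‖_w ≤ ε` and
EVERY finite family `γ'` of further closed walks with ARBITRARY real couplings `c'`, the action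
`Σ_i c_i Re tr U_{γ_i}/N + Σ_j c'_j Re tr U_{γ'_j}/N` has exactly one DLR state (the tilt of the ball member's state by
`e^{−Σ_j c'_j Re tr U_{γ'_j}/N}`, `eq_tilted_of_mem_perturbedGibbsMeasuresS_add`). -/
theorem hasUniqueGibbsMeasure_loopBall_add_loops {β w ε : ℝ} (hball : MassGapOnLoopBall d N β w ε)
    {γ : ι → ZdLoop d} {c : ι → ℝ} (hfin : ∀ X, {i | walkEdges (γ i).walk = X}.Finite) (hc : LoopNormLE w γ c ε)
    [Fintype ι'] (γ' : ι' → ZdLoop d) (c' : ι' → ℝ) :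
    HasUniqueGibbsMeasure (perturbedYMS (d := d) (fundamentalRep (Fin N)) (N * β)
      (loopFamilyAction (d := d) N γ c + loopFamilyAction (d := d) N γ' c')) := by
  classical
  have hmem : MemBallZdS (2 * ε) ε w (loopFamilyAction (d := d) N γ c) := memBallZdS_loopFamilyAction hfin hc
  have hV := memBallZd_loopFamilyAction_fintype (N := N) γ' c'
  have hT : ∀ Λ, loopSupp γ' Λ ⊆ Finset.univ.image fun i => walkEdges (γ' i).walk := fun Λ =>
    Finset.image_subset_image (Finset.subset_univ _)
  exact hasUniqueGibbsMeasure_add_of_perturbedMassGapAtS hmem (hball ι γ c hfin hc) hV.continuous hV.dependsOn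
    hV.supportedBy hT

/-- **`SU(2)`, `ℤ⁴`, `β_W = 1/16`**: every generic Wilson-type loop action with finite carrier fibres and
`‖c‖_{log 2} ≤ 0.143`, plus finitely many further loops with arbitrary real couplings, has exactly one DLR state
(row `su2_massGapOnLoopBall_1_16`). -/
theorem su2_loopBall_add_loops_hasUniqueGibbsMeasure_1_16 {γ : ι → ZdLoop 4} {c : ι → ℝ}
    (hfin : ∀ X, {i | walkEdges (γ i).walk = X}.Finite) (hc : LoopNormLE (Real.log 2) γ c (143 / 1000))
    [Fintype ι'] (γ' : ι' → ZdLoop 4) (c' : ι' → ℝ) :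
    HasUniqueGibbsMeasure (perturbedYMS (d := 4) (fundamentalRep (Fin 2)) (2 * ((1 / 16 : ℝ) / 4))
      (loopFamilyAction (d := 4) 2 γ c + loopFamilyAction (d := 4) 2 γ' c')) :=
  hasUniqueGibbsMeasure_loopBall_add_loops su2_massGapOnLoopBall_1_16 hfin hc γ' c'

/-- **`SU(2)`, `ℤ⁴`, `β_W = 1/20`**: the same with `‖c‖_{log 2} ≤ 0.209` (row `su2_massGapOnLoopBall_1_20`). -/
theorem su2_loopBall_add_loops_hasUniqueGibbsMeasure_1_20 {γ : ι → ZdLoop 4} {c : ι → ℝ}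
    (hfin : ∀ X, {i | walkEdges (γ i).walk = X}.Finite) (hc : LoopNormLE (Real.log 2) γ c (209 / 1000))
    [Fintype ι'] (γ' : ι' → ZdLoop 4) (c' : ι' → ℝ) :
    HasUniqueGibbsMeasure (perturbedYMS (d := 4) (fundamentalRep (Fin 2)) (2 * ((1 / 20 : ℝ) / 4))
      (loopFamilyAction (d := 4) 2 γ c + loopFamilyAction (d := 4) 2 γ' c')) :=
  hasUniqueGibbsMeasure_loopBall_add_loops su2_massGapOnLoopBall_1_20 hfin hc γ' c'

/-- **Every `N ≥ 2`, `ℤ⁴`, 't Hooft coupling `1/64`**: every generic Wilson-type loop action with finite carrier fibres and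
`‖c‖_{log (6/5)} ≤ 1/40`, plus finitely many further loops with arbitrary real couplings, has exactly one DLR state
(row `suN_massGapOnLoopBall_1_64`). -/
theorem suN_loopBall_add_loops_hasUniqueGibbsMeasure_1_64 (hN : 2 ≤ N) {γ : ι → ZdLoop 4} {c : ι → ℝ}
    (hfin : ∀ X, {i | walkEdges (γ i).walk = X}.Finite) (hc : LoopNormLE (Real.log (6 / 5)) γ c (1 / 40))
    [Fintype ι'] (γ' : ι' → ZdLoop 4) (c' : ι' → ℝ) :
    HasUniqueGibbsMeasure (perturbedYMS (d := 4) (fundamentalRep (Fin N)) (N * (1 / 64 : ℝ))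
      (loopFamilyAction (d := 4) N γ c + loopFamilyAction (d := 4) N γ' c')) :=
  hasUniqueGibbsMeasure_loopBall_add_loops (suN_massGapOnLoopBall_1_64 hN) hfin hc γ' c'

end Loops

/-! ### One loop: the source term and the catalogue energy -/

section Single

/-- The one-loop source on its carrier: `loopFamilyAction N (· ↦ ⟨x, w⟩) (· ↦ t)` at the link set of `w` IS `t · Re tr U_w/N`. -/
theorem loopFamilyAction_single_apply {x : Literature.Probability.LatticeModels.Site d} (w : (zdGraph d).Walk x x) (t : ℝ) :
    loopFamilyAction (d := d) N (fun _ : Unit => (⟨x, w⟩ : ZdLoop d)) (fun _ => t) (walkEdges w) = loopTerm (d := d) N t w := by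
  classical
  funext U
  simp only [loopFamilyAction, indexedPotential_apply]
  have hfib : carrierFib (fun _ : Unit => walkEdges w) (walkEdges w) = Finset.univ := by
    ext i
    simp only [Finset.mem_univ, iff_true]
    exact (mem_carrierFib (fun _ => Set.toFinite _) _ i).2 rfl
  rw [hfib, Fintype.sum_unique]

/-- The catalogue energy of the one-loop source with coupling `1`: `Σ_{A ∈ {links of w}} V_A = Re tr U_w / N`. -/
theorem sum_singleLoop_source {x : Literature.Probability.LatticeModels.Site d} (w : (zdGraph d).Walk x x)
    (U : LGConfig d (SUN N)) :
    ∑ A ∈ (Finset.univ : Finset Unit).image (fun _ => walkEdges w),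
        loopFamilyAction (d := d) N (fun _ : Unit => (⟨x, w⟩ : ZdLoop d)) (fun _ => (1 : ℝ)) A U =
      loopTerm (d := d) N 1 w U := by
  classical
  rw [Finset.image_const Finset.univ_nonempty, Finset.sum_singleton, loopFamilyAction_single_apply]

end Single

/-! ### The gauge-invariant tier-1 ball plus finitely many loops of any strength -/

section Gauge

variable {ι' : Type*}

/-- ★ **EVERY MEMBER OF THE GAUGE-INVARIANT BALL PLUS FINITELY MANY LOOPS OF ANY STRENGTHS HAS ONE DLR STATE**: if
`UniformMassGapOnBallZdG d N β ε₀ ε₁ R m A` holds, then for every member `(W, supp)` of `MemBallZdG ε₀ ε₁ R` and every finite family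
`γ'` of closed walks with arbitrary real couplings `c'`, `W + Σ_j c'_j Re tr U_{γ'_j}/N` has exactly one DLR state. -/
theorem hasUniqueGibbsMeasure_add_loops_of_uniformMassGapOnBallZdG {β ε₀ ε₁ m A : ℝ} {R : ℕ}
    (h : UniformMassGapOnBallZdG d N β ε₀ ε₁ R m A)
    {W : Potential (ZdEdge d) (SUN N)} {supp : Finset (ZdEdge d) → Finset (Finset (ZdEdge d))}
    (hW : MemBallZdG ε₀ ε₁ R W supp) [Fintype ι'] (γ' : ι' → ZdLoop d) (c' : ι' → ℝ) :
    HasUniqueGibbsMeasure (perturbedYM (d := d) (fundamentalRep (Fin N)) (N * β)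
      (W + loopFamilyAction (d := d) N γ' c') (fun Λ => supp Λ ∪ loopSupp γ' Λ)) := by
  classical
  have hV := memBallZd_loopFamilyAction_fintype (N := N) γ' c'
  have hVa : (loopFamilyAction (d := d) N γ' c').IsAdapted := fun X => ⟨hV.dependsOn X, (hV.continuous X).measurable⟩
  have hVb : ∀ X, ∃ C, ∀ U, |loopFamilyAction (d := d) N γ' c' X U| ≤ C := fun X =>
    exists_bound_of_continuous (hV.continuous X)
  have hT : ∀ Λ, loopSupp γ' Λ ⊆ Finset.univ.image fun i => walkEdges (γ' i).walk := fun Λ =>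
    Finset.image_subset_image (Finset.subset_univ _)
  exact hasUniqueGibbsMeasure_add_of_uniformMassGapOnBallZdG h hW hVa hVb hV.supportedBy hT

/-- **THE `SU(2)` WILSON POINT ON `ℤ⁴`, `0 ≤ β_W ≤ 1/3`, FINITELY MANY LOOPS OF ANY STRENGTHS CREATE NO PHASE**: for every finite
family `γ'` of closed walks and all real couplings `c'`, the Wilson action at `β_W` (tree coupling `β_W/2`) with
`Σ_j c'_j Re tr U_{γ'_j}/2` inserted has exactly one DLR state. -/
theorem su2_wilson_loops_hasUniqueGibbsMeasure_upTo_oneThird {βW : ℝ} (h0 : 0 ≤ βW) (h1 : βW ≤ 1 / 3)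
    [Fintype ι'] (γ' : ι' → ZdLoop 4) (c' : ι' → ℝ) :
    HasUniqueGibbsMeasure (perturbedYM (d := 4) (fundamentalRep (Fin 2)) (2 * (βW / 4))
      (loopFamilyAction 2 γ' c') (loopSupp γ')) := by
  obtain ⟨m, -, hball⟩ := su2_uniformStar_upTo_oneThird
  have hmem : MemBallZdG (N := 2) (d := 4) (3 / 125) (3 / 250) 0 0 (fun _ => (∅ : Finset (Finset (ZdEdge 4)))) :=
    memBallZdG_zero (by norm_num) (by norm_num) 0
  have key := hasUniqueGibbsMeasure_add_loops_of_uniformMassGapOnBallZdG (hball βW h0 h1 0) hmem γ' c'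
  simpa only [zero_add, Finset.empty_union, Nat.cast_ofNat] using key

end Gauge

end Summit.Ventures.YMGap.RobustBall

end
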